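import Summits.QuantumAdvantage.QuantumAdvantage.Theorems.SosSandwichTransferPBQueryCrux
import Summits.QuantumAdvantage.QuantumAdvantage.Theorems.SosSandwichPseudoBoundedAAQuerySimulable
import Summits.QuantumAdvantage.QuantumAdvantage.Theses.RandomOracleGauge
import HarnessLib

/-!
# The shared crux `RandomOracleHeurSeparation` (stmt-QuantumAdvantage-1131): route `RandomOracleGauge` also needs only `AA_Q`

The hypothesis-type crux `X_ROG` (stmt-1131) is an item of BOTH routes SosSandwich and RandomOracleGauge (and `PromiseLanguageLift`,
stmt-0250, likewise).  After the circuit→query bridge (`Theorems/SosSandwichCircuitToQuery.lean`, `…QueryPathBridge.lean`,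
`…TransferPBQueryCrux.lean`) the SosSandwich assembly runs from `AA_Q` — the Aaronson–Ambainis conjecture for quantum QUERY
acceptance probabilities.  This file records, BY NAME on the RandomOracleGauge route file, that the same is true there:

* `randomOracleHeurSeparation_iff`, `promiseLanguageLift_iff`, `aaConj_iff` — the two routes' copies of X, PL, and
  `RandomOracleGauge.AAConj` vs the Literature `AAConjecture`, agree verbatim (`Iff.rfl`);
* **`rog_quantumAdvantage_of_aaQuery : AA_Q → RandomOracleGauge.RandomOracleHeurSeparation → RandomOracleGauge.PromiseLanguageLift
  → QuantumAdvantage`** — RandomOracleGauge's deciding theorem `closes` needs, besides X and PL, its closed crux `PromiseTransfer`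
  and the conjecture `AAConj` (derived there from the three open split pieces `DecoupledCoreAA`, `OneBlockDecoupling`,
  `VarianceAmplification`); in the tree ALL of that analytic input can be replaced by the strictly downstream `AA_Q`
  (`AAConjecture ⟹ AA_Q`, `aaQuery_of_aaConjecture`), the transfer being the landed `QueryCrux.transfer_of_aaQuery`;
* `rog_quantumAdvantage_of_aaConj` — in particular `AAConj ∧ X ∧ PL ⟹ QuantumAdvantage` without the `PromiseTransfer`
  hypothesis (it is a theorem) and without the split.

Honest label: bookkeeping across two route files (compositions of landed theorems, conditional on open hypotheses); nothing
closes.  No new definitions.  Sources: AaronsonAmbainis2014 Thm. 7 (iii), Conj. 6.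
-/

noncomputable section

-- D-0017: single-conjunct summit ⇒ the duplicate `QuantumAdvantage.QuantumAdvantage` is mandated.
set_option linter.dupNamespace false

namespace Summit.QuantumAdvantage.QuantumAdvantage.Theorems.SosSandwich.RandomOracleGaugeLink

open Literature.Computability.Cryptography Literature.Computability.QuantumComplexity
open Summit.QuantumAdvantage.QuantumAdvantage.Theses

/-- The two route files state the crux X (stmt-1131) verbatim up to unfolding (`randomOracleMeasure = randomOracle`,
`Barriers….AvgPRel = Complexity.AvgPRel` are definitional). [cite: AaronsonAmbainis2014, Thm. 7 (iii)] -/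
theorem randomOracleHeurSeparation_iff :
    SosSandwich.RandomOracleHeurSeparation ↔ RandomOracleGauge.RandomOracleHeurSeparation := Iff.rfl

/-- The two route files state the lift PL (stmt-0250) verbatim. [cite: Goldreich2011, §1] -/
theorem promiseLanguageLift_iff : SosSandwich.PromiseLanguageLift ↔ RandomOracleGauge.PromiseLanguageLift := Iff.rfl

/-- `RandomOracleGauge.AAConj` is the Literature conjecture `AAConjecture` verbatim. [cite: AaronsonAmbainis2014, Conj. 6] -/
theorem aaConj_iff : RandomOracleGauge.AAConj ↔ AAConjecture := Iff.rfl

/-- **Route RandomOracleGauge's assembly from `AA_Q` alone on the analytic side**: `AA_Q → X → PL → QuantumAdvantage` on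
ITS decls (the SosSandwich chain `QueryCrux.quantumAdvantage_of_aaQuery` read through the verbatim agreement of the two
route files).  Compare its `closes : PromiseTransfer → X → PL → AAConjAssembly → DecoupledCoreAA → OneBlockDecoupling →
VarianceAmplification → QuantumAdvantage`: the transfer is a theorem and the whole AA side weakens to `AA_Q`.
[cite: AaronsonAmbainis2014, Thm. 7 (iii)] -/
theorem rog_quantumAdvantage_of_aaQuery
    (hAAQ : ∃ (c : ℕ) (C : ℝ), 0 < C ∧ ∀ (N : ℕ) (Q : QQueryAlg N) (p : MvPolynomial (Fin N) ℝ) (ε : ℝ),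
      1 ≤ Q.queries → (∀ x, evalBool p x = Q.acceptProb x) → 0 < ε → ε ≤ boolVariance p →
        ∃ i : Fin N, C * (ε / Q.queries) ^ c ≤ influence i p)
    (hX : RandomOracleGauge.RandomOracleHeurSeparation) (hPL : RandomOracleGauge.PromiseLanguageLift) :
    _root_.QuantumAdvantage :=
  QueryCrux.quantumAdvantage_of_aaQuery hAAQ (randomOracleHeurSeparation_iff.2 hX) (promiseLanguageLift_iff.2 hPL)

/-- **`AAConj ∧ X ∧ PL ⟹ QuantumAdvantage`** on RandomOracleGauge's decls, with neither the `PromiseTransfer` hypothesis nor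
the three-piece split (`aaQuery_of_aaConjecture` then `rog_quantumAdvantage_of_aaQuery`). [cite: AaronsonAmbainis2014, Thm. 7 (iii)] -/
theorem rog_quantumAdvantage_of_aaConj (hAA : RandomOracleGauge.AAConj) (hX : RandomOracleGauge.RandomOracleHeurSeparation)
    (hPL : RandomOracleGauge.PromiseLanguageLift) : _root_.QuantumAdvantage :=
  rog_quantumAdvantage_of_aaQuery (aaQuery_of_aaConjecture (aaConj_iff.1 hAA)) hX hPL

/-- **Route RandomOracleGauge's registered `Assembly` item (stmt-10750) holds outright**:
`PromiseTransfer → X → PL → AAConj → QuantumAdvantage` (the first hypothesis is not even used: the transfer is a theorem).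
[cite: AaronsonAmbainis2014, Thm. 7 (iii)] -/
theorem rog_assembly : RandomOracleGauge.Assembly :=
  fun _ hX hPL hAA => rog_quantumAdvantage_of_aaConj hAA hX hPL

end Summit.QuantumAdvantage.QuantumAdvantage.Theorems.SosSandwich.RandomOracleGaugeLink

end
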